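import Mathlib
import HarnessLib
import Summits.NavierStokesRegularity.FluidComputer.TriggeredTransferCascadeClock
import Summits.NavierStokesRegularity.FluidComputer.TriggeredTransferZoom
import Summits.NavierStokesRegularity.FluidComputer.TriggeredTransferDataZoom
import Summits.NavierStokesRegularity.FluidComputer.TriggeredTransferH1Junction

/-!
# The pieces of a CASCADE at their physical scale: zoomed classical solutions, triggers, energies,
# hand-over identities, and the junction by `H¹` (door N1-FC, analysis half v2, file 3/5)

Cell `ns-blowup`, seat `ns-blowup-fc-prover-1` (g5; D-0074 GROUP C «bridge support», door N1-FC).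
This is `TriggeredTransferPieces.lean` (this seat, g2) re-run over the ALPHABET-FREE type
`TriggerScheme.Cascade ν` (`TriggeredTransferCascade.lean`), with the ONE substantive change the v2
door exists for: **the junction datum is `H¹` because the cascade says so (`Cascade.h1`), not because
it is a zoomed Clay member** — the `H¹` clauses pass through the data zoom by `regular_zoom`
(`TriggeredTransferH1Junction.lean`, seat `ns-blowup-fc-prover-2` g5, door v2 module B, filed from the
line owner's RULING ns-blowup STATUS l.3869). Everything else (the Leray zoom
`vel/prs/frc`, `piece_classical`, the exact hand-over `vel_start_succ`, support and `C^m` sizes of the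
zoomed triggers, energies, the unforced translated pieces) is the g2 text with `ρ : 𝒮.Cascade ν`
(explicit binder in every signature; theorems about a different type than `Run`'s). LABEL: E–C
bookkeeping. WHAT THIS IS NOT: not Navier–Stokes evidence and not a construction — statements about
a `Cascade`, a type inhabited in the tree only under OPEN door predicates; no instance is claimed.

**The junction** (`vel_eq_vel_succ`): on the overlap `[start (n+1), stop n]` the physical pieces of
levels `n` and `n+1` are UNFORCED classical finite-energy solutions from the same zoomed `H¹` datum,
hence EQUAL by Tao's unconditional uniqueness (Anal. PDE 2013, Cor. 11.4) — the tree THEOREM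
`tao_unconditional_uniqueness_velocity_holds` (`u₀ ∈ L²`, `∇u₀ ∈ L²`, nothing about decay); no named
fact is assumed.

References: J. Leray, Acta Math. 63 (1934) §20 [cite: Leray1934, §20]; T. Tao, Anal. PDE 6 (2013)
Cor. 11.4 [cite: Tao2011, Cor. 11.4]; T. Tao, J. Amer. Math. Soc. 29 (2016) §1.3
[cite: Tao2016AveragedNS, §1.3]. 0 sorry; axioms ⊆ {propext, Classical.choice, Quot.sound}.
-/

noncomputable section

namespace Summit.NavierStokesRegularity.FluidComputer.TriggeredTransfer

open Set Filter Function MeasureTheory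
open scoped Topology ENNReal ContDiff
open Literature.Analysis.FluidPDE
open Literature.Analysis.FluidPDE.FluidComputer (E3 Vel)

namespace TriggerScheme.Cascade

variable {𝒮 : TriggerScheme} {ν : ℝ}

/-! ## The physical pieces -/

/-- **Velocity of the physical piece of level `n`**: the Leray zoom
`(t, x) ↦ λⁿ • u_n (λ^{2n} (t - start n)) (λⁿ • (x - centre n))` of the unit-scale piece. [cite: Leray1934, §20] -/
def vel (ρ : 𝒮.Cascade ν) (n : ℕ) : ℝ → Vel :=
  𝒮.mag n • stPull (𝒮.mag n ^ 2) (𝒮.mag n) (-(𝒮.mag n ^ 2 * ρ.start n)) (-(𝒮.mag n • ρ.centre n))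
    (ρ.link n).u

/-- **Pressure of the physical piece of level `n`** (`× λ^{2n}`). [cite: Leray1934, §20] -/
def prs (ρ : 𝒮.Cascade ν) (n : ℕ) : ℝ → E3 → ℝ :=
  𝒮.mag n ^ 2 • stPull (𝒮.mag n ^ 2) (𝒮.mag n) (-(𝒮.mag n ^ 2 * ρ.start n)) (-(𝒮.mag n • ρ.centre n))
    (ρ.link n).p

/-- **The zoomed trigger of level `n`** (`× λ^{3n}`). [cite: Leray1934, §20] -/
def frc (ρ : 𝒮.Cascade ν) (n : ℕ) : ℝ → Vel :=
  (𝒮.mag n ^ 2 * 𝒮.mag n) • stPull (𝒮.mag n ^ 2) (𝒮.mag n) (-(𝒮.mag n ^ 2 * ρ.start n))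
    (-(𝒮.mag n • ρ.centre n)) (ρ.link n).g

/-- The affine time argument of the zoom, simplified. [folklore] -/
theorem zoom_time (ρ : 𝒮.Cascade ν) (n : ℕ) (t : ℝ) :
    -(𝒮.mag n ^ 2 * ρ.start n) + 𝒮.mag n ^ 2 * t = 𝒮.mag n ^ 2 * (t - ρ.start n) := by ring

/-- The affine space argument of the zoom, simplified. [folklore] -/
theorem zoom_space (ρ : 𝒮.Cascade ν) (n : ℕ) (x : E3) :
    -(𝒮.mag n • ρ.centre n) + 𝒮.mag n • x = 𝒮.mag n • (x - ρ.centre n) := by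
  rw [smul_sub]; abel

/-- Unfolding `vel`. [folklore] -/
theorem vel_apply (ρ : 𝒮.Cascade ν) (n : ℕ) (t : ℝ) (x : E3) :
    ρ.vel n t x = 𝒮.mag n • (ρ.link n).u (𝒮.mag n ^ 2 * (t - ρ.start n)) (𝒮.mag n • (x - ρ.centre n)) := by
  simp only [vel, Pi.smul_apply, stPull_apply, ρ.zoom_time, ρ.zoom_space]

/-- Unfolding `prs`. [folklore] -/
theorem prs_apply (ρ : 𝒮.Cascade ν) (n : ℕ) (t : ℝ) (x : E3) :
    ρ.prs n t x =
      𝒮.mag n ^ 2 • (ρ.link n).p (𝒮.mag n ^ 2 * (t - ρ.start n)) (𝒮.mag n • (x - ρ.centre n)) := by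
  simp only [prs, Pi.smul_apply, stPull_apply, ρ.zoom_time, ρ.zoom_space]

/-- Unfolding `frc`. [folklore] -/
theorem frc_apply (ρ : 𝒮.Cascade ν) (n : ℕ) (t : ℝ) (x : E3) :
    ρ.frc n t x = (𝒮.mag n ^ 2 * 𝒮.mag n) •
      (ρ.link n).g (𝒮.mag n ^ 2 * (t - ρ.start n)) (𝒮.mag n • (x - ρ.centre n)) := by
  simp only [frc, Pi.smul_apply, stPull_apply, ρ.zoom_time, ρ.zoom_space]

/-- The time slices of the physical velocity are data zooms of the unit-scale slices:
`vel n t = zoom (mag n) (centre n) (u_n (λ^{2n} (t - start n)))`. [folklore] -/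
theorem vel_eq_zoom (ρ : 𝒮.Cascade ν) (n : ℕ) (t : ℝ) :
    ρ.vel n t = zoom (𝒮.mag n) (ρ.centre n) ((ρ.link n).u (𝒮.mag n ^ 2 * (t - ρ.start n))) := by
  funext x
  rw [vel_apply, zoom_apply]

/-! ## The physical pieces are classical solutions -/

/-- The zoom maps the physical slab onto the unit-scale slab:
`{t | -λ^{2n} start n + λ^{2n} t ∈ [0, T_n + δ_n]} = [start n, start n + dur n + margin n]`. [folklore] -/
theorem preimage_slab (ρ : 𝒮.Cascade ν) (n : ℕ) :
    (fun r => -(𝒮.mag n ^ 2 * ρ.start n) + 𝒮.mag n ^ 2 * r) ⁻¹' Icc 0 ((ρ.link n).T + (ρ.link n).δ) =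
      Icc (ρ.start n) (ρ.start n + ρ.dur n + ρ.margin n) := by
  have hm : 𝒮.mag n ^ 2 ≠ 0 := (pow_pos (𝒮.mag_pos n) 2).ne'
  rw [preimage_affine_Icc (pow_pos (𝒮.mag_pos n) 2)]
  have ha : (0 - -(𝒮.mag n ^ 2 * ρ.start n)) / 𝒮.mag n ^ 2 = ρ.start n := by
    rw [div_eq_iff hm]
    ring
  have hb : ((ρ.link n).T + (ρ.link n).δ - -(𝒮.mag n ^ 2 * ρ.start n)) / 𝒮.mag n ^ 2 =
      ρ.start n + ρ.dur n + ρ.margin n := by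
    rw [div_eq_iff hm, add_mul, add_mul, mul_comm (ρ.dur n), ρ.mag_sq_mul_dur, mul_comm (ρ.margin n),
      ρ.mag_sq_mul_margin]
    ring
  rw [ha, hb]

/-- Local (unit-scale) time of a physical time in the slab of level `n` lies in `[0, T_n + δ_n]`. [folklore] -/
theorem loc_mem (ρ : 𝒮.Cascade ν) (n : ℕ) {t : ℝ} (ht : t ∈ Icc (ρ.start n) (ρ.start n + ρ.dur n + ρ.margin n)) :
    𝒮.mag n ^ 2 * (t - ρ.start n) ∈ Icc 0 ((ρ.link n).T + (ρ.link n).δ) := by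
  have h := ρ.preimage_slab n
  have ht' : t ∈ (fun r => -(𝒮.mag n ^ 2 * ρ.start n) + 𝒮.mag n ^ 2 * r) ⁻¹'
      Icc 0 ((ρ.link n).T + (ρ.link n).δ) := by rw [h]; exact ht
  simpa only [mem_preimage, ρ.zoom_time] using ht'

/-- **The physical piece of level `n` is an exact classical solution** of the system forced by the
zoomed trigger, with the SAME viscosity, on `[start n, start n + dur n + margin n]`
(`IsClassicalNSSolutionOn.stRescale` with `α = γ = λⁿ`, `β = λ^{2n}`). [cite: Leray1934, §20] -/
theorem piece_classical (ρ : 𝒮.Cascade ν) (n : ℕ) :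
    IsClassicalNSSolutionOn (Icc (ρ.start n) (ρ.start n + ρ.dur n + ρ.margin n)) ν (ρ.frc n)
      (ρ.vel n) (ρ.prs n) := by
  have key := (ρ.link n).classical.stRescale (𝒮.mag_pos n) (𝒮.mag_pos n) (sq (𝒮.mag n))
    (-(𝒮.mag n ^ 2 * ρ.start n)) (-(𝒮.mag n • ρ.centre n))
  have hν : 𝒮.mag n * ν / 𝒮.mag n = ν := by
    field_simp [(𝒮.mag_pos n).ne']
  rw [ρ.preimage_slab n, hν] at key
  exact key

/-! ## Values: the start slice and the exact hand-over -/

/-- The physical piece of level `n` starts from the zoomed level state: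
`vel n (start n) = zoom (mag n) (centre n) (w n)`. [folklore] -/
theorem vel_start (ρ : 𝒮.Cascade ν) (n : ℕ) : ρ.vel n (ρ.start n) = zoom (𝒮.mag n) (ρ.centre n) (ρ.w n) := by
  rw [vel_eq_zoom, sub_self, mul_zero, ρ.u_zero]

/-- The zoom about the next centre, unfolded at the parent's scale:
`λ • (λⁿ • (x - centre n) - x₀_n) = λ^{n+1} • (x - centre (n+1))`. [folklore] -/
theorem lam_smul_sub_x₀ (ρ : 𝒮.Cascade ν) (n : ℕ) (x : E3) :
    𝒮.lam • (𝒮.mag n • (x - ρ.centre n) - (ρ.link n).x₀) =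
      𝒮.mag (n + 1) • (x - ρ.centre (n + 1)) := by
  have hm : 𝒮.mag n ≠ 0 := (𝒮.mag_pos n).ne'
  have h1 : 𝒮.mag n • (x - ρ.centre (n + 1)) = 𝒮.mag n • (x - ρ.centre n) - (ρ.link n).x₀ := by
    rw [ρ.centre_succ, sub_add_eq_sub_sub, smul_sub (𝒮.mag n) (x - ρ.centre n), smul_smul,
      mul_inv_cancel₀ hm, one_smul]
  rw [𝒮.mag_succ, mul_comm, ← smul_smul, h1]

/-- **The exact hand-over at physical scale**: at `start (n+1)` the piece of level `n` IS the zoomed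
next level state, `vel n (start (n+1)) = zoom (mag (n+1)) (centre (n+1)) (w (n+1))`. [folklore] -/
theorem vel_start_succ (ρ : 𝒮.Cascade ν) (n : ℕ) :
    ρ.vel n (ρ.start (n + 1)) = zoom (𝒮.mag (n + 1)) (ρ.centre (n + 1)) (ρ.w (n + 1)) := by
  rw [vel_eq_zoom, ρ.start_succ, add_sub_cancel_left, ρ.mag_sq_mul_dur, ρ.handover n]
  funext x
  simp only [zoom_apply]
  rw [smul_smul, ← 𝒮.mag_succ, ρ.lam_smul_sub_x₀]

/-- The two consecutive pieces agree at the hand-over time (no uniqueness needed). [folklore] -/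
theorem vel_start_succ_eq (ρ : 𝒮.Cascade ν) (n : ℕ) : ρ.vel n (ρ.start (n + 1)) = ρ.vel (n + 1) (ρ.start (n + 1)) := by
  rw [vel_start_succ, vel_start]

/-- **The datum at a start time is smooth, divergence free and an `H¹` datum** (`L²` with `L²`
gradient): it is the zoom of a level state of the cascade, and `H¹` passes through the data zoom
(`regular_zoom`, `TriggeredTransferH1Junction.lean`, seat `ns-blowup-fc-prover-2` g5). This — and
not rapid decay — is what the junction consumes. [folklore] -/
theorem regular_vel_start (ρ : 𝒮.Cascade ν) (n : ℕ) :
    ContDiff ℝ ∞ (ρ.vel n (ρ.start n)) ∧ NSWave0.IsDivFree (ρ.vel n (ρ.start n)) ∧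
      MemLp (ρ.vel n (ρ.start n)) 2 volume ∧ MemLp (fderiv ℝ (ρ.vel n (ρ.start n))) 2 volume := by
  rw [vel_start]
  exact regular_zoom ⟨ρ.contDiff_w n, ρ.isDivFree_w n, (ρ.h1 n).1, (ρ.h1 n).2⟩ (𝒮.mag_pos n) _

/-! ## The zoomed triggers: support and size -/

/-- The zoomed trigger of level `n` is OFF during the initial layer: `t ≤ start n + margin n`. [folklore] -/
theorem frc_eq_zero_of_le (ρ : 𝒮.Cascade ν) {n : ℕ} {t : ℝ} (ht : t ≤ ρ.start n + ρ.margin n) : ρ.frc n t = 0 := by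
  have hloc : 𝒮.mag n ^ 2 * (t - ρ.start n) ≤ (ρ.link n).δ := by
    calc 𝒮.mag n ^ 2 * (t - ρ.start n) ≤ 𝒮.mag n ^ 2 * ρ.margin n :=
          mul_le_mul_of_nonneg_left (by linarith) (pow_pos (𝒮.mag_pos n) 2).le
      _ = (ρ.link n).δ := ρ.mag_sq_mul_margin n
  funext x
  rw [frc_apply, (ρ.link n).g_eq_zero_of_le_δ hloc, Pi.zero_apply, smul_zero, Pi.zero_apply]

/-- The zoomed trigger of level `n` is OFF from the hand-over on: `start (n+1) ≤ t`. [folklore] -/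
theorem frc_eq_zero_of_ge (ρ : 𝒮.Cascade ν) {n : ℕ} {t : ℝ} (ht : ρ.start (n + 1) ≤ t) : ρ.frc n t = 0 := by
  have hloc : (ρ.link n).T ≤ 𝒮.mag n ^ 2 * (t - ρ.start n) := by
    rw [ρ.start_succ] at ht
    calc (ρ.link n).T = 𝒮.mag n ^ 2 * ρ.dur n := (ρ.mag_sq_mul_dur n).symm
      _ ≤ 𝒮.mag n ^ 2 * (t - ρ.start n) :=
          mul_le_mul_of_nonneg_left (by linarith) (pow_pos (𝒮.mag_pos n) 2).le
  funext x
  rw [frc_apply, (ρ.link n).g_eq_zero_of_T_le hloc, Pi.zero_apply, smul_zero, Pi.zero_apply]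

/-- The zoomed trigger of level `n` vanishes outside the blow-up ball `B̄(0, ballRadius)`. [folklore] -/
theorem frc_apply_eq_zero_of_far (ρ : 𝒮.Cascade ν) {n : ℕ} (t : ℝ) {x : E3} (hx : 𝒮.ballRadius ≤ ‖x‖) :
    ρ.frc n t x = 0 := by
  rw [frc_apply, (ρ.link n).trigger.off_far _ _ (ρ.R_le_norm_mag_smul_sub n hx), smul_zero]

/-- The zoomed trigger is a smooth space–time field. [folklore] -/
theorem contDiff_frc (ρ : 𝒮.Cascade ν) (n : ℕ) : ContDiff ℝ ∞ (uncurry (ρ.frc n)) :=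
  contDiff_uncurry_smul_stPull (ρ.link n).trigger.smooth _ _ _ _ _

/-- **`C^m` size of the zoomed trigger**: `‖D^m (frc n) (z)‖ ≤ A_m · (mag n)^{3+2m} · ε_n` — the
amplitude `λ^{3n}`, `λ^{2n}` per derivative from the zoom, and the seed's `‖D^m g_n‖ ≤ ε_n A_m`. [folklore] -/
theorem norm_iteratedFDeriv_frc_le (ρ : 𝒮.Cascade ν) (n m : ℕ) (z : ℝ × E3) :
    ‖iteratedFDeriv ℝ m (uncurry (ρ.frc n)) z‖ ≤
      𝒮.A m * (𝒮.mag n ^ (3 + 2 * m) * 𝒮.seedAt ν n (ρ.U n)) := by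
  have hψ : ContDiff ℝ m (uncurry (ρ.link n).g) :=
    (ρ.link n).trigger.smooth.of_le (by exact_mod_cast le_top)
  have hm1 : 1 ≤ 𝒮.mag n := 𝒮.one_le_mag n
  have hmax : max (𝒮.mag n ^ 2) (𝒮.mag n) = 𝒮.mag n ^ 2 :=
    max_eq_left (by nlinarith)
  refine (norm_iteratedFDeriv_smul_stPull_le hψ _ (pow_pos (𝒮.mag_pos n) 2).le (𝒮.mag_pos n).le
    _ _ z).trans ?_
  rw [hmax, abs_of_pos (mul_pos (pow_pos (𝒮.mag_pos n) 2) (𝒮.mag_pos n))]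
  have hsmall := (ρ.link n).trigger.small m
    (-(𝒮.mag n ^ 2 * ρ.start n) + 𝒮.mag n ^ 2 * z.1, -(𝒮.mag n • ρ.centre n) + 𝒮.mag n • z.2)
  calc 𝒮.mag n ^ 2 * 𝒮.mag n * (𝒮.mag n ^ 2) ^ m *
        ‖iteratedFDeriv ℝ m (uncurry (ρ.link n).g)
          (-(𝒮.mag n ^ 2 * ρ.start n) + 𝒮.mag n ^ 2 * z.1, -(𝒮.mag n • ρ.centre n) + 𝒮.mag n • z.2)‖
      ≤ 𝒮.mag n ^ 2 * 𝒮.mag n * (𝒮.mag n ^ 2) ^ m * (𝒮.seedAt ν n (ρ.U n) * 𝒮.A m) :=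
        mul_le_mul_of_nonneg_left hsmall (by positivity)
    _ = 𝒮.A m * (𝒮.mag n ^ (3 + 2 * m) * 𝒮.seedAt ν n (ρ.U n)) := by ring

/-- **Summable `C^m` sizes**: for every `m`, the bounds `A_m (mag n)^{3+2m} ε_n` of the zoomed
triggers are summable in the level (`ν > 0`). [folklore] -/
theorem summable_frc_bound (ρ : 𝒮.Cascade ν) (hν : 0 < ν) (m : ℕ) :
    Summable (fun n : ℕ => 𝒮.A m * (𝒮.mag n ^ (3 + 2 * m) * 𝒮.seedAt ν n (ρ.U n))) :=
  (ρ.summable_mag_pow_mul_seedAt hν (3 + 2 * m)).mul_left _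

/-! ## Energies -/

/-- **Finite energy of the physical pieces**: on its slab the piece of level `n` has
`∫ ‖vel n t‖² ≤ λ^{2n} λ^{-3n} C_n < ∞`. [folklore] -/
theorem piece_energy (ρ : 𝒮.Cascade ν) (n : ℕ) :
    ∃ C : ℝ≥0∞, C < ⊤ ∧ ∀ t ∈ Icc (ρ.start n) (ρ.start n + ρ.dur n + ρ.margin n),
      ∫⁻ x, ‖ρ.vel n t x‖ₑ ^ 2 ≤ C := by
  obtain ⟨C, hC, hb⟩ := (ρ.link n).energy
  refine ⟨ENNReal.ofReal (𝒮.mag n ^ 2) * ENNReal.ofReal (𝒮.mag n ^ 3)⁻¹ * C,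
    ENNReal.mul_lt_top (ENNReal.mul_lt_top ENNReal.ofReal_lt_top ENNReal.ofReal_lt_top) hC,
    fun t ht => ?_⟩
  rw [ρ.vel_eq_zoom, lintegral_enorm_sq_zoom (𝒮.mag_pos n)]
  exact mul_le_mul' le_rfl (hb _ (ρ.loc_mem n ht))

/-- Finite energy of a physical piece, after a time translation, on a sub-slab. [folklore] -/
theorem piece_energy_translate (ρ : 𝒮.Cascade ν) (n : ℕ) {a τ : ℝ} (ha : ρ.start n ≤ a)
    (hτ : a + τ ≤ ρ.start n + ρ.dur n + ρ.margin n) :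
    ∃ C : ℝ≥0∞, C < ⊤ ∧ ∀ s ∈ Icc 0 τ, ∫⁻ x, ‖ρ.vel n (s + a) x‖ₑ ^ 2 ≤ C := by
  obtain ⟨C, hC, hb⟩ := ρ.piece_energy n
  exact ⟨C, hC, fun s hs => hb (s + a) ⟨by linarith [hs.1], by linarith [hs.2]⟩⟩

/-! ## The junction: consecutive pieces agree on the unforced overlap -/

/-- The piece of level `n`, translated to start the clock at `a ≥ start (n+1)`, is an UNFORCED
classical solution on `[0, τ]` as long as `a + τ` stays in its slab. [folklore] -/
theorem piece_unforced_late (ρ : 𝒮.Cascade ν) (n : ℕ) {a τ : ℝ} (ha : ρ.start (n + 1) ≤ a) (hτ : 0 < τ)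
    (hlife : a + τ ≤ ρ.start n + ρ.dur n + ρ.margin n) :
    IsClassicalNSSolutionOn (Icc 0 τ) ν 0 (fun s => ρ.vel n (s + a)) (fun s => ρ.prs n (s + a)) := by
  have h := (ρ.piece_classical n).comp_add_right a
  have hsub : Icc 0 τ ⊆ (· + a) ⁻¹' Icc (ρ.start n) (ρ.start n + ρ.dur n + ρ.margin n) := by
    intro s hs
    simp only [mem_preimage, mem_Icc]
    constructor
    · linarith [hs.1, ρ.start_lt_start_succ n]
    · linarith [hs.2]
  refine (h.mono hsub (uniqueDiffOn_Icc hτ)).force_congr fun s hs => ?_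
  show ρ.frc n (s + a) = 0
  exact ρ.frc_eq_zero_of_ge (by linarith [hs.1])

/-- The piece of level `n+1`, translated to start the clock at `a ≥ start (n+1)`, is an UNFORCED
classical solution on `[0, τ]` as long as `a + τ ≤ start (n+1) + margin (n+1)`. [folklore] -/
theorem piece_unforced_early (ρ : 𝒮.Cascade ν) (n : ℕ) {a τ : ℝ} (ha : ρ.start (n + 1) ≤ a) (hτ : 0 < τ)
    (hearly : a + τ ≤ ρ.start (n + 1) + ρ.margin (n + 1)) :
    IsClassicalNSSolutionOn (Icc 0 τ) ν 0 (fun s => ρ.vel (n + 1) (s + a))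
      (fun s => ρ.prs (n + 1) (s + a)) := by
  have h := (ρ.piece_classical (n + 1)).comp_add_right a
  have hsub : Icc 0 τ ⊆
      (· + a) ⁻¹' Icc (ρ.start (n + 1)) (ρ.start (n + 1) + ρ.dur (n + 1) + ρ.margin (n + 1)) := by
    intro s hs
    simp only [mem_preimage, mem_Icc]
    constructor
    · linarith [hs.1]
    · linarith [hs.2, (ρ.dur_pos (n + 1)).le]
  refine (h.mono hsub (uniqueDiffOn_Icc hτ)).force_congr fun s hs => ?_
  show ρ.frc (n + 1) (s + a) = 0
  exact ρ.frc_eq_zero_of_le (by linarith [hs.2])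

/-- **THE JUNCTION.** On the overlap `[start (n+1), stop n]` the physical pieces of levels `n` and
`n+1` COINCIDE: both are unforced there (`frc n` is off from `start (n+1)` on, `frc (n+1)` is off
until `start (n+1) + margin (n+1) ≥ stop n`), both are classical with finite energy, and both start
at `start (n+1)` from the same zoomed `H¹` datum (`vel_start_succ_eq`, `regular_vel_start`); Tao's unconditional uniqueness (Anal. PDE 2013,
Cor. 11.4 — the tree theorem `tao_unconditional_uniqueness_velocity_holds`) identifies them.
[cite: Tao2011, Cor. 11.4] -/
theorem vel_eq_vel_succ (ρ : 𝒮.Cascade ν) (hν : 0 < ν) (n : ℕ) {t : ℝ}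
    (ht : t ∈ Icc (ρ.start (n + 1)) (ρ.stop n)) : ρ.vel n t = ρ.vel (n + 1) t := by
  rcases ht.1.eq_or_lt with h | h
  · rw [← h, vel_start_succ_eq]
  · have hτ : 0 < t - ρ.start (n + 1) := sub_pos.2 h
    have hlife : ρ.start (n + 1) + (t - ρ.start (n + 1)) ≤ ρ.start n + ρ.dur n + ρ.margin n := by
      linarith [ρ.stop_le_life n, ht.2]
    have hearly : ρ.start (n + 1) + (t - ρ.start (n + 1)) ≤ ρ.start (n + 1) + ρ.margin (n + 1) := by
      linarith [ρ.stop_le_start_succ_add_margin n, ht.2]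
    have h1 := ρ.piece_unforced_late n le_rfl hτ hlife
    have h2 := ρ.piece_unforced_early n le_rfl hτ hearly
    -- the common datum
    obtain ⟨-, -, hL2, hH1⟩ := ρ.regular_vel_start (n + 1)
    have hv1 : (fun s => ρ.vel n (s + ρ.start (n + 1))) 0 = ρ.vel (n + 1) (ρ.start (n + 1)) := by
      simp only [zero_add]
      exact ρ.vel_start_succ_eq n
    have hv2 : (fun s => ρ.vel (n + 1) (s + ρ.start (n + 1))) 0 = ρ.vel (n + 1) (ρ.start (n + 1)) := by
      simp only [zero_add]
    -- the energies
    have hE1 := ρ.piece_energy_translate n (ρ.start_lt_start_succ n).le hlife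
    have hE2 := ρ.piece_energy_translate (n + 1) le_rfl
      (hearly.trans (by linarith [(ρ.dur_pos (n + 1)).le]))
    have key := tao_unconditional_uniqueness_velocity_holds ν (t - ρ.start (n + 1)) hν hτ _ hL2 hH1
      _ _ _ _ h1 h2 hv1 hv2 hE1 hE2 (t - ρ.start (n + 1)) ⟨hτ.le, le_rfl⟩
    simpa only [sub_add_cancel] using key

/-- The junction on the open overlap (the form `IsClassicalNSSolutionOn.glue` consumes). [cite: Tao2011, Cor. 11.4] -/
theorem vel_eq_vel_succ_Ioo (ρ : 𝒮.Cascade ν) (hν : 0 < ν) (n : ℕ) {t : ℝ}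
    (ht : t ∈ Ioo (ρ.start (n + 1)) (ρ.stop n)) : ρ.vel n t = ρ.vel (n + 1) t :=
  ρ.vel_eq_vel_succ hν n ⟨ht.1.le, ht.2.le⟩

end TriggerScheme.Cascade

end Summit.NavierStokesRegularity.FluidComputer.TriggeredTransfer

end
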